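import Literature.NumberTheory.Automorphic.UnitaryGroupRankOneAntidiagEntries   -- ★ F2a (this seat): Borel ∕ scalar ∕ anti-diagonal members of `U(J₂)(K)`, Δ-identities
import Mathlib.LinearAlgebra.Matrix.Charpoly.Coeff
import Mathlib.FieldTheory.Separable
import HarnessLib

/-!
# Every ADMISSIBLE class `(t, Δ)` (`σΔ·Δ = 1`, `σt·Δ = t`) of the quasi-split rank-one unitary group `U(J₂)(K)` is the class of a SEMISIMPLE element
(regular semisimple — separable `X² − tX + Δ` — or scalar), realised by the anti-diagonal family ∕ the scalars (Rogawski 1990 §3.1, §1.10; Hilbert 90 in rank one)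

Topic `NumberTheory/Automorphic`; namespace `Literature.NumberTheory.Automorphic.UnitaryGroup`.  THEOREMS ONLY (no definition, no instance, no notation,
no named fact, no `sorry`); FIELD-GENERIC (`K` a field with `2 ≠ 0`, `σ` an involution with an anti-invariant unit `ν₀`).  Cell `pub/hodgecm-mathlib`
(D-0151), crux H413 = stmt-HodgeConjecture-24833, F0∕P3a road «D-N6-ns», line «N6nsGerm», stub `stub_N6nsGlue` SATURATION HALF (LEAD F0P3a-plan (g9) T8-55 →
B-p08 (g26)), census item «realisation ∕ (σ-DENSE) (n1)».  HONEST LABEL: HC_CM is proved only modulo the 2 remaining named inputs (hLiu418, h413) until rung 0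
closes; this file proves no letter.

THE MATHEMATICS.  Let `(t, Δ) ∈ K²` be ADMISSIBLE: `σΔ·Δ = 1` and `σt·Δ = t` (the identities every class of `U(J₂)(K)` satisfies, ★ `sigma_det_mul_det_of_mem`,
★ `sigma_trace_mul_det_of_mem`).  (i) If `t² ≠ 4Δ`, Hilbert 90 in rank one gives `r = z − Δ·σz ≠ 0` (`z ∈ {1, ν₀}`) with `r = −Δ·σr`, and the anti-diagonal
unitary `g(t, r) = (0 (σr)⁻¹; r t)` (★ `antidiagFamily_mem_unitaryGroupOfForm_antidiag`) has class `(t, Δ)` and SEPARABLE characteristic polynomial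
`X² − tX + Δ` (Bezout: `(2X − t)² − 4(X² − tX + Δ) = t² − 4Δ ∈ Kˣ`).  (ii) If `t² = 4Δ`, the scalar `a = t/2` satisfies `σa·a = 1`, so `a·1 ∈ U(J₂)(K)` has class
`(t, Δ)`.  Hence EVERY admissible class is the class of a semisimple element (`exists_mem_trace_det_eq_semisimple_of_admissible`) — the realisation half of
«saturation» (Langlands–Shelstad 1990 §2.2: limits of regular classes are classes of semisimple elements).

## References
* [Rogawski1990] J. D. Rogawski, *Automorphic Representations of Unitary Groups in Three Variables*, Ann. of Math. Stud. 123 (1990), §1.10 p. 9, §3.1 p. 19.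
* [LanglandsShelstad1990Descent] R. P. Langlands, D. Shelstad, *Descent for transfer factors*, Progr. Math. 87 (1990), §2.2 p. 11.
* [HornJohnson2013] R. A. Horn, C. R. Johnson, *Matrix Analysis*, 2nd ed. (2013), 1.2 (characteristic polynomial of a `2 × 2` matrix).
-/

set_option autoImplicit false

noncomputable section

open Matrix Polynomial
open scoped MatrixGroups

namespace Literature.NumberTheory.Automorphic.UnitaryGroup

open Literature.NumberTheory.Automorphic

variable {K : Type*} [Field K] {σ : K →+* K}

/-- **Separability of a quadratic with invertible discriminant**: `X² − tX + Δ` is separable when `t² − 4Δ ≠ 0` (Bezout with `2X − t`).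
[cite: HornJohnson2013, 1.2] -/
theorem separable_X_sq_sub_of_disc_ne_zero {t d : K} (hD : t * t - 4 * d ≠ 0) : (X ^ 2 - C t * X + C d : K[X]).Separable := by
  rw [Polynomial.separable_def]
  have hder : derivative (X ^ 2 - C t * X + C d : K[X]) = 2 * X - C t := by
    simp only [derivative_add, derivative_sub, derivative_X_pow, derivative_mul, derivative_C, derivative_X, zero_mul, zero_add, mul_one,
      add_zero, Nat.cast_ofNat, map_ofNat, Nat.add_one_sub_one, pow_one]
  rw [hder]
  have key : (2 * X - C t : K[X]) * (2 * X - C t) - 4 * (X ^ 2 - C t * X + C d) = C (t * t - 4 * d) := by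
    rw [map_sub, map_mul, map_mul, map_ofNat]; ring
  refine ⟨-4 * C (t * t - 4 * d)⁻¹, C (t * t - 4 * d)⁻¹ * (2 * X - C t), ?_⟩
  have hC : C (t * t - 4 * d)⁻¹ * C (t * t - 4 * d) = (1 : K[X]) := by rw [← map_mul, inv_mul_cancel₀ hD, map_one]
  linear_combination (C (t * t - 4 * d)⁻¹) * key + hC

/-- **Hilbert 90 in rank one, explicit**: for `σΔ·Δ = 1` there is `r ≠ 0` with `r = −Δ·σr` (`r = z − Δσz`, `z = 1` or `z = ν₀`).
[cite: Rogawski1990, §1.10 p. 9] -/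
theorem exists_ne_zero_eq_neg_mul_sigma (h2 : (2 : K) ≠ 0) {ν₀ : K} (hν₀ : σ ν₀ = -ν₀) (hν₀0 : ν₀ ≠ 0) {d : K}
    (hd : σ d * d = 1) : ∃ r : K, r ≠ 0 ∧ r = -(d * σ r) := by
  by_cases hd1 : d = 1
  · refine ⟨ν₀ + ν₀, ?_, ?_⟩
    · rw [← two_mul]; exact mul_ne_zero h2 hν₀0
    · rw [hd1, map_add, hν₀]; ring
  · refine ⟨1 - d, sub_ne_zero.2 (Ne.symm hd1), ?_⟩
    rw [map_sub, map_one]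
    linear_combination (-1 : K) * hd

/-- **EVERY ADMISSIBLE CLASS OF `U(J₂)(K)` IS THE CLASS OF A SEMISIMPLE ELEMENT.**  For `σΔ·Δ = 1`, `σt·Δ = t` there is `g ∈ U(J₂)(K)` with `tr g = t`,
`det g = Δ`, and either `χ_g = X² − tX + Δ` separable (regular semisimple) or `g = a·1` scalar. [cite: Rogawski1990, §3.1 p. 19, §1.10 p. 9]
[cite: LanglandsShelstad1990Descent, §2.2 p. 11] -/
theorem exists_mem_trace_det_eq_semisimple_of_admissible (hσ : ∀ x, σ (σ x) = x) (h2 : (2 : K) ≠ 0) {ν₀ : K} (hν₀ : σ ν₀ = -ν₀) (hν₀0 : ν₀ ≠ 0)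
    {t d : K} (hd : σ d * d = 1) (ht : σ t * d = t) :
    ∃ g : GL (Fin 2) K, g ∈ unitaryGroupOfForm σ !![(0 : K), 1; 1, 0] ∧ g.val.trace = t ∧ g.val.det = d ∧
      (g.val.charpoly.Separable ∨ ∃ a : K, g.val = a • (1 : Matrix (Fin 2) (Fin 2) K)) := by
  have hd0 : d ≠ 0 := fun h => by rw [h, mul_zero] at hd; exact zero_ne_one hd
  have hσd : σ d = d⁻¹ := eq_inv_of_mul_eq_one_left hd
  have hσt : σ t = t * σ d := by
    rw [hσd, eq_mul_inv_iff_mul_eq₀ hd0]; exact ht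
  by_cases hD : t * t - 4 * d = 0
  · -- scalar `a = t/2`
    have h4 : (4 : K) ≠ 0 := by
      have : (4 : K) = 2 * 2 := by norm_num
      rw [this]; exact mul_ne_zero h2 h2
    set a : K := t / 2 with ha_def
    have hta : t = 2 * a := by rw [ha_def]; field_simp
    have htt : t * t = 4 * d := sub_eq_zero.1 hD
    have hσa : σ a * a = 1 := by
      have h : σ a * a * 4 = 1 * 4 := by
        calc σ a * a * 4 = σ (2 * a) * (2 * a) := by rw [map_mul, map_ofNat]; ring
          _ = σ t * t := by rw [← hta]
          _ = 1 * 4 := by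
            rw [hσt, hσd, mul_assoc, mul_comm d⁻¹ t, ← mul_assoc, htt]
            field_simp
      exact mul_right_cancel₀ h4 h
    have ha0 : a ≠ 0 := fun h => by rw [h, mul_zero] at hσa; exact zero_ne_one hσa
    obtain ⟨h1, h1'⟩ := scalar_mul_scalarInv_eq_one ha0
    refine ⟨⟨_, _, h1, h1'⟩, scalar_mem_unitaryGroupOfForm_antidiag hσa h1 h1', ?_, ?_, Or.inr ⟨a, ?_⟩⟩
    · show (!![a, 0; 0, a]).trace = t
      rw [Matrix.trace_fin_two_of, hta, two_mul]
    · show (!![a, 0; 0, a]).det = d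
      rw [Matrix.det_fin_two_of]
      have h := htt
      rw [hta] at h
      apply mul_left_cancel₀ h4
      linear_combination h
    · show !![a, 0; 0, a] = a • (1 : Matrix (Fin 2) (Fin 2) K)
      ext i j; fin_cases i <;> fin_cases j <;> simp
  · -- regular semisimple: the anti-diagonal unitary `g(t, r)`
    obtain ⟨r, hr, hrσ⟩ := exists_ne_zero_eq_neg_mul_sigma h2 hν₀ hν₀0 hd
    have hσr : σ r ≠ 0 := fun h => hr (by rw [← hσ r, h, map_zero])
    have hσr' : σ r = -(σ d * r) := by
      have h := congr_arg σ hrσ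
      rw [map_neg, map_mul, hσ] at h
      exact h
    have htr : σ t * r + t * σ r = 0 := by
      rw [hσt, hσr']; ring
    obtain ⟨h1, h1'⟩ := antidiagFamily_mul_inv_eq_one hσ hr htr
    refine ⟨⟨_, _, h1, h1'⟩, antidiagFamily_mem_unitaryGroupOfForm_antidiag hσ hr htr h1 h1', ?_, ?_, Or.inl ?_⟩
    · show (!![0, (σ r)⁻¹; r, t]).trace = t
      rw [Matrix.trace_fin_two_of, zero_add]
    · show (!![0, (σ r)⁻¹; r, t]).det = d
      rw [Matrix.det_fin_two_of, zero_mul, zero_sub, inv_mul_eq_div, neg_eq_iff_eq_neg, div_eq_iff hσr]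
      -- `r = −Δ σr`
      linear_combination hrσ
    · show (!![0, (σ r)⁻¹; r, t]).charpoly.Separable
      rw [Matrix.charpoly_fin_two, Matrix.trace_fin_two_of, Matrix.det_fin_two_of, zero_add, zero_mul, zero_sub, inv_mul_eq_div]
      have hdet : -(r / σ r) = d := by rw [neg_eq_iff_eq_neg, div_eq_iff hσr]; linear_combination hrσ
      rw [hdet]
      exact separable_X_sq_sub_of_disc_ne_zero hD

end Literature.NumberTheory.Automorphic.UnitaryGroup

end
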